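import Summits.CriticalPhenomena.PercolationContinuityZ3.Theorems.PercNearOneGluingAdditiveGluingUCTBridge
import Summits.CriticalPhenomena.PercolationContinuityZ3.Theorems.PercNearOneGluingNoHeavyLowerTailCovTauOfTA
import HarnessLib

/-!
# Crux `PercNearOneGluing.AdditiveGluing` (stmt-CriticalPhenomena-4576), line `tieline`:
# the kernel (T) = `stub_k0CovTransferQ_c9`, PROVED

Stub landing (`--supports stmt-CriticalPhenomena-4576`; seat (d) exchange-certificate form, gen 12).  No definitions, no named
facts, no sorries.

The registered stub `stub_k0CovTransferQ_c9` of the skeleton `Cruxes/AdditiveGluing/Lines/tieline.lean` (lead c9–c15) is the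
5-point covariance transfer for `Q`,
`μ(D)·(Q_o μ(N) − Q_c μ(N ∩ o↔c)) ≤ μ(D ∩ u↔b)·(a_o μ(N) − a_c μ(N ∩ o↔c))`, `D = {u ↮ v}`, `N = {c ↮ u} ∩ {c ↮ v}`,
`Q_x = μ(D ∩ u↔b ∩ v↔x)`, `a_x = μ(D ∩ v↔x)`.

PROOF (two accepted files composed):
* `UCTBridge.covTransferQ_of_uct_at` (…AdditiveGluingUCTBridge.lean, p204423): the covariance-transfer principle (UCT) for
  monotone functionals of the open edge cluster of `v` under `{u ↮ v}` implies (T) (van den Berg–Häggström–Kahn's display (10));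
* `CovTau.markerDominanceAvoid` (…NoHeavyLowerTailCovTauOfTA.lean, prim-hp-7): the functional marker dominance lemma with an
  avoided set, MDL(X), UNCONDITIONAL — which under the dictionary `(s, X, y, z) := (v, {u}, c, o)` is literally UCT:
  `μ(c ↮ {u,v}, c ↔ o)·cov_D(F, 1{v↔c}) ≤ μ(c ↮ {u,v})·cov_D(F, 1{v↔o})`, `D = {v ↮ u}`.
(The degenerate case `v = c` is `0 ≤ 0`.)  So the seat's paper chain EXCHCERT-g10/PROOF-UCT (telescoping along the BHK
heat-bath chain ⟶ T1 ⟶ induction with Gladkov's decision-tree Harris inequality) is exactly prim-hp-7's landed `T_A` chain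
for the sister crux `NoHeavyLowerTail` (`HullPort.markerDominanceAvoid_of_TA`, `HullPort.taQ_nonneg_of_PvI`, `HullPort.CE_holds`).
[cite: VandenbergHaggstromKahn2005, Thms. 1.3–1.5 (pp. 6–8), §2.1 (pp. 9–13)] [cite: Gladkov2024, Thm. 3.2]
[cite: KozmaNitzan2024, Question 7 (p. 36)]
-/

namespace Summit.CriticalPhenomena.PercolationContinuityZ3.Cruxes.AdditiveGluing.TieLine

open MeasureTheory Set
open Literature.Probability.LatticeModels (prodBernoulli)
open Literature.Probability.Percolation
open Summit.CriticalPhenomena.PercolationContinuityZ3.Theorems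

noncomputable section

namespace K0CovTransferQ

variable {V : Type*} [Fintype V]

omit [Fintype V] in
/-- `{v ↮ x, x ∈ {u}} = {u ↔ v}ᶜ`. [folklore] -/
theorem setD_eq (v u : V) :
    {ω : BondConfig V | ∀ x ∈ ({u} : Set V), ¬ (openGraph ω).Reachable v x} = (openConn u v)ᶜ := by
  ext ω
  simp only [mem_setOf_eq, mem_singleton_iff, forall_eq, mem_compl_iff, openConn]
  exact ⟨fun h h' => h h'.symm, fun h h' => h h'.symm⟩

omit [Fintype V] in
/-- `{c ↮ x, x ∈ {v, u}} = {c ↔ u}ᶜ ∩ {c ↔ v}ᶜ`. [folklore] -/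
theorem setN_eq (v u c : V) :
    {ω : BondConfig V | ∀ x ∈ insert v ({u} : Set V), ¬ (openGraph ω).Reachable c x} =
      (openConn c u)ᶜ ∩ (openConn c v)ᶜ := by
  ext ω
  simp only [mem_setOf_eq, mem_insert_iff, mem_singleton_iff, forall_eq_or_imp, forall_eq, mem_inter_iff,
    mem_compl_iff, openConn]
  exact ⟨fun h => ⟨h.2, h.1⟩, fun h => ⟨h.2, h.1⟩⟩

/-- **(UCT) at the roles `(v, u, o, c)`** — the covariance-transfer principle for monotone functionals `F` of the open edge
cluster of `v` under `D = {u ↮ v}`: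
`μ(N ∩ o↔c)·(μ(D)∫_{D∩v↔c} F − (∫_D F) μ(D∩v↔c)) ≤ μ(N)·(μ(D)∫_{D∩v↔o} F − (∫_D F) μ(D∩v↔o))`, `N = {c↮u} ∩ {c↮v}`.
This is `CovTau.markerDominanceAvoid` at `(s, X, y, z) := (v, {u}, c, o)` (and `0 ≤ 0` when `v = c`).
[cite: VandenbergHaggstromKahn2005, §2.1 (pp. 9–13)] [cite: Gladkov2024, Thm. 3.2] -/
theorem uct_at (w : Sym2 V → unitInterval) (v u o c : V) (F : Set (Sym2 V) → ℝ) (hF : Monotone F) :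
    (prodBernoulli w).real ((openConn c u)ᶜ ∩ (openConn c v)ᶜ ∩ openConn o c : Set (BondConfig V)) *
        ((prodBernoulli w).real ((openConn u v)ᶜ : Set (BondConfig V)) *
            (∫ ω in ((openConn u v)ᶜ ∩ openConn v c : Set (BondConfig V)), F (openEdgeCluster ω v) ∂(prodBernoulli w)) -
          (∫ ω in ((openConn u v)ᶜ : Set (BondConfig V)), F (openEdgeCluster ω v) ∂(prodBernoulli w)) *
            (prodBernoulli w).real ((openConn u v)ᶜ ∩ openConn v c : Set (BondConfig V))) ≤
      (prodBernoulli w).real ((openConn c u)ᶜ ∩ (openConn c v)ᶜ : Set (BondConfig V)) *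
        ((prodBernoulli w).real ((openConn u v)ᶜ : Set (BondConfig V)) *
            (∫ ω in ((openConn u v)ᶜ ∩ openConn v o : Set (BondConfig V)), F (openEdgeCluster ω v) ∂(prodBernoulli w)) -
          (∫ ω in ((openConn u v)ᶜ : Set (BondConfig V)), F (openEdgeCluster ω v) ∂(prodBernoulli w)) *
            (prodBernoulli w).real ((openConn u v)ᶜ ∩ openConn v o : Set (BondConfig V))) := by
  by_cases hvc : v = c
  · subst hvc
    have h0 : ((openConn v u)ᶜ ∩ (openConn v v)ᶜ : Set (BondConfig V)) = ∅ := by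
      ext ω
      simp only [mem_inter_iff, mem_compl_iff, openConn, mem_setOf_eq, mem_empty_iff_false, iff_false, not_and,
        not_not]
      exact fun _ => SimpleGraph.Reachable.refl v
    rw [h0, Set.empty_inter, measureReal_empty, zero_mul, zero_mul]
  · have h := CovTau.markerDominanceAvoid w v c o ({u} : Set V) hvc F hF
    have hco : (openConn c o : Set (BondConfig V)) = openConn o c := by
      ext ω
      exact ⟨fun h => SimpleGraph.Reachable.symm h, fun h => SimpleGraph.Reachable.symm h⟩
    rw [setD_eq, setN_eq, hco] at h
    exact h

end K0CovTransferQ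

open K0CovTransferQ in
/-- **Stub (T) = `stub_k0CovTransferQ_c9`, PROVED** (registered signature verbatim): the 5-point covariance transfer for `Q`,
`μ(D)·(Q_o μ(N) − Q_c μ(N∩o↔c)) ≤ μ(D∩u↔b)·(a_o μ(N) − a_c μ(N∩o↔c))`.  Proof: `UCTBridge.covTransferQ_of_uct` fed with
`K0CovTransferQ.uct_at` (= `CovTau.markerDominanceAvoid`).
[cite: KozmaNitzan2024, Question 7 (p. 36)] [cite: VandenbergHaggstromKahn2005, Thms. 1.3–1.5, §2.1] [cite: Gladkov2024, Thm. 3.2] -/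
theorem stub_k0CovTransferQ_c9 : ∀ (n : ℕ) (w : Sym2 (Fin n) → unitInterval) (o b u v c : Fin n), (Literature.Probability.LatticeModels.prodBernoulli w).real ((Literature.Probability.Percolation.openConn u v)ᶜ : Set (Literature.Probability.Percolation.BondConfig (Fin n))) * ((Literature.Probability.LatticeModels.prodBernoulli w).real ((Literature.Probability.Percolation.openConn u v)ᶜ ∩ Literature.Probability.Percolation.openConn u b ∩ Literature.Probability.Percolation.openConn v o : Set (Literature.Probability.Percolation.BondConfig (Fin n))) * (Literature.Probability.LatticeModels.prodBernoulli w).real ((Literature.Probability.Percolation.openConn c u)ᶜ ∩ (Literature.Probability.Percolation.openConn c v)ᶜ : Set (Literature.Probability.Percolation.BondConfig (Fin n))) - (Literature.Probability.LatticeModels.prodBernoulli w).real ((Literature.Probability.Percolation.openConn u v)ᶜ ∩ Literature.Probability.Percolation.openConn u b ∩ Literature.Probability.Percolation.openConn v c : Set (Literature.Probability.Percolation.BondConfig (Fin n))) * (Literature.Probability.LatticeModels.prodBernoulli w).real ((Literature.Probability.Percolation.openConn c u)ᶜ ∩ (Literature.Probability.Percolation.openConn c v)ᶜ ∩ Literature.Probability.Percolation.openConn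 o c : Set (Literature.Probability.Percolation.BondConfig (Fin n)))) ≤ (Literature.Probability.LatticeModels.prodBernoulli w).real ((Literature.Probability.Percolation.openConn u v)ᶜ ∩ Literature.Probability.Percolation.openConn u b : Set (Literature.Probability.Percolation.BondConfig (Fin n))) * ((Literature.Probability.LatticeModels.prodBernoulli w).real ((Literature.Probability.Percolation.openConn u v)ᶜ ∩ Literature.Probability.Percolation.openConn v o : Set (Literature.Probability.Percolation.BondConfig (Fin n))) * (Literature.Probability.LatticeModels.prodBernoulli w).real ((Literature.Probability.Percolation.openConn c u)ᶜ ∩ (Literature.Probability.Percolation.openConn c v)ᶜ : Set (Literature.Probability.Percolation.BondConfig (Fin n))) - (Literature.Probability.LatticeModels.prodBernoulli w).real ((Literature.Probability.Percolation.openConn u v)ᶜ ∩ Literature.Probability.Percolation.openConn v c : Set (Literature.Probability.Percolation.BondConfig (Fin n))) * (Literature.Probability.LatticeModels.prodBernoulli w).real ((Literature.Probability.Percolation.openConn c u)ᶜ ∩ (Literature.Probability.Percolation.openConn c v)ᶜ ∩ Literature.Probability.Percolation.openConn o c : Set (Literature.Probability.Percolation.BondConfig (Fin n)))) :=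
  UCTBridge.covTransferQ_of_uct fun _ w v u o c F hF => uct_at w v u o c F hF

end

end Summit.CriticalPhenomena.PercolationContinuityZ3.Cruxes.AdditiveGluing.TieLine
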